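import Summits.QuantumFields.QCD.Theses.QuarkMassMonotone

/-!
# Birth skeleton (BC3) for crux `ChirallyAnchoredQCDTwo` (item stmt-QuantumFields-17306) — `Lines/birth.lean`

Route `route-QuantumFields-QuarkMassMonotone` (sub-problem QCD), crux decl
`Summit.QuantumFields.QCD.Theses.QuarkMassMonotone.ChirallyAnchoredQCDTwo` (rank 4, open-problem): the CHIRALLY
ANCHORED `N_f = 2` SOCKET — one mass-independent regularisation `reg : QCDRegularisation 2` with (a) `HasMassScaling`,
(b) `IsChiralAtZero`, (c) below every positive mass tuple `m` a certified gapped ANCHOR `m⋆` (`0 < m⋆_f ≤ m_f`, the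
route's fixed-`k` RAY CERTIFICATE along the bare ray above `m⋆(k)` and one uniform lattice rate `Δ⋆ > 0`), and (d) the
continuum body of `QCDOf 2` (species renormalisations, OS data `T` with `IsQCDAlong`, non-trivial non-Gaussian glue,
dynamical quarks, `T.HasMassGap Δ`) at EVERY positive tuple.  The route's `closes` feeds (c) into the rank-2 crux
`LatticeGapMonotone` to recover the `∀ m` lattice-gap clause of `QCDOf 2`.

Registered by the skeleton-registrar seat `planner-skel-stmt-QuantumFields-17306-0` (route re-audit bin REPAIRABLE,
2026-08-17).  LINE = THE DEGENERATE DIAGONAL OF A CORNER-PINNED REGULARISATION (the route header's foreseen split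
`DiagonalLatticeAnchors₂ → ContinuumBodyOfPinned₂ → ChirallyAnchoredQCDTwo`, typed, with the chiral clause factored
through the `N_f = 2` instance of the vetted sibling crux `EulerDescent.ChiralCornerSoftness` and the order transfer
made explicit).  `N_f = 2` throughout; the junk-excluding hypothesis set of the three `∀ reg` stubs is EulerDescent's
PINNED PACKAGE (corner `IsLUB`, pin `→ 0`, `HasMassScaling`, two-loop `HasAsymptoticScaling`, `m_crit(k) > −1`
eventually; refuter-checked on items 16900/16902: "none of corner/pin/MS/AS droppable"), which ties renormalised masses
to honest light quarks and so keeps decoupled witnesses (`m_crit ≡ 20`) out: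

* `stub_pinnedDoubletAnchors` (∃-form; THE `N_f = 2` LATTICE HEART, size XL / open): a regularisation pinned at the
  intrinsic Wilson corner whose DEGENERATE doublets `(η, η)`, `η > 0` — exactly where the Wilson weight
  `det D_W(m)² ≥ 0` is a positive measure (tree: `IsGammaHermitian.det_sq_nonneg`,
  `WilsonDeterminantSign.pow_even_nonneg`), so reflection-positivity / probabilistic constructions are admissible —
  carry the ray certificate and a uniform lattice gap `Δ(η) > 0` in physical units.
* `stub_chiralCornerSoftnessTwo` (GOLDSTONE INPUT, open): every corner-pinned `N_f = 2` regularisation is chiral at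
  zero.  Literally `EulerDescent.ChiralCornerSoftness 2 (Or.inl rfl)` (item stmt-QuantumFields-16902, refuter-checked
  2026-08-16) — stated inline so that this file imports its own route file only; the one-line derivation from the
  EulerDescent decl is kernel-checked in the registrar's folder (`bc/link_check.lean`), not here.
* `stub_doubletOrderTransfer` (THE ROUTE'S LEVER IN ITS WEAKEST NEEDED FORM, size XL): on a corner-pinned `N_f = 2`
  regularisation a uniform lattice rate at the certified degenerate doublet `(η, η)` transfers, undiminished, to every
  tuple `m ≥ (η, η)` — the `N_f = 2`, degenerate-base, pinned special case of the rank-2 crux `LatticeGapMonotone`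
  (kernel-checked `example` below: `LatticeGapMonotone →` stub 3), where every SPLIT tuple (signed weight,
  `Literature.Barriers.QuantumFields.WilsonDeterminantMassSplitting`) receives its gap by ORDER.
* `stub_continuumBodyOfPinnedTwo` (THE CONTINUUM HALF for the SAME `reg`, size XL / open): a corner-pinned `N_f = 2`
  regularisation with a uniform lattice gap at every positive tuple carries the continuum body at every positive tuple
  (full-sequence convergence with some species renormalisations, E0–E4, non-trivial non-Gaussian glue, dynamical
  flavour-changing pseudoscalars, `T.HasMassGap`) — the route header's `ContinuumBodyOfPinned₂`; same-`reg` shape as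
  `EulerDescent.RetypedContinuumComplement` but with the pin in place of the heavy body.

`ChirallyAnchoredQCDTwo_of : PinnedDoubletAnchors → ChiralCornerSoftnessTwo → DoubletOrderTransfer → ContinuumBodyOfPinnedTwo →
ChirallyAnchoredQCDTwo` (the four stub statements are the named `def … : Prop` of §1, each inhabited only by its
`stub_*`) is kernel-checked (no `sorry`, axioms `propext, Classical.choice, Quot.sound`): for a positive
tuple `m` the anchor is the degenerate doublet at `η = min (m 0) (m 1)`; S3 transports its rate to `m`, so every
positive tuple is lattice-gapped; S2 gives `IsChiralAtZero`; S4 the body; all four stubs are load-bearing.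

## Negative knowledge honoured
* `ledger negatives --problem QuantumFields` (2026-08-17): no refuted statement concerns anchored sockets, order
  transfer in the mass, chirality of a pinned regularisation or the continuum half at fixed `reg`; no stub is an
  instance of a refuted statement (see the line card for the list read).
* `Cruxes/ChirallyAnchoredQCDTwo/`: no `Disproof.lean`, no prior workfiles or crux ideas (`ledger crux ls`, 2026-08-17).
* Landed chirality obstruction `RobustYangMillsHandover.Negative.not_isChiralAtZero_mcrit_shift_of_uniformGapAbove`
  (a bare `m_crit` shift of a uniformly gapped regularisation is never chiral at zero): honoured — no stub shifts
  `m_crit`; chirality comes from the intrinsic corner pin (S2), and S1's rates `Δ(η)` are free to vanish as `η → 0⁺`.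
* Route-internal negative edge: the degenerate-case check of the route header (doubler branch `κ ∈ (−1/8, 0)`, where
  lattice masses DEcrease in the bare mass) is why S3 carries the ray certificate and the pin (`m_crit > −1`).
-/

namespace Summit.QuantumFields.QCD.Cruxes.ChirallyAnchoredQCDTwo.Birth

open Filter
open Literature.MathematicalPhysics.QuantumFieldTheory
open Summit.QuantumFields.QCD.Theses.QuarkMassMonotone (LatticeGapMonotone ChirallyAnchoredQCDTwo)

/-! ## §1 The four stub STATEMENTS (named propositions, `@[stub "birth"]` obligation nodes = the admissible hypotheses of
`ChirallyAnchoredQCDTwo_of`; `N_f = 2`; verbatim sub-formulas of the route file).  The tags are LIVE in the registrar's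
work copy `bc/ChirallyAnchoredQCDTwo_birth.lean` (byte-identical otherwise), on which `ledger skeleton check … --crux
stmt-QuantumFields-17306` reported OK (closed=True, 4 stubs registered); they are commented in this tree copy because crux
workfiles may not carry gate-reserved attributes. -/

/-- **Statement of stub S1 — pinned degenerate-doublet anchors — THE `N_f = 2` LATTICE HEART** (∃-form).  There are a two-flavour
regularisation `reg` and a corner sequence `mc` such that: eventually in `k`, `mc k` is the least upper bound of the
degenerate bare Wilson masses at which lattice QCD at coupling `β_k` is NOT massive (EulerDescent's intrinsic corner);
`(m_crit(k) − mc(k))·Z_m(k)/a_k → 0` (the pin); `HasMassScaling`; two-loop `HasAsymptoticScaling`; `m_crit(k) > −1`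
eventually (Lüscher positivity range); AND for every renormalised mass `η > 0` the DEGENERATE doublet `(η, η)` carries
the route's ray certificate (eventually in `k`, every flavour-blind upward shift `t ≥ 0` of its bare tuple clusters at
some lattice rate `δ(k,t) > 0`, uniformly over all pairs of gauge-invariant local observables and all large tori) and a
uniform lattice gap `(reg.scheme (η,η) 0 0).HasLatticeMassGap Δ` for some `Δ > 0`.  The weight at every doublet used
is `det D_W(m)² ≥ 0`.  Open (light two-flavour Wilson lattice QCD gapped uniformly along an asymptotically free
sequence; fixed-`k` clustering along heavy rays is proved only at strong coupling / small `κ`). [folklore] -/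
-- @[stub "birth"] (tag LIVE in the registrar seat's registered work copy `bc/ChirallyAnchoredQCDTwo_birth.lean`, on which `ledger skeleton check` ran; commented here: crux workfiles may not carry gate-reserved attributes)
def PinnedDoubletAnchors : Prop :=
  ∃ (reg : QCDRegularisation 2) (mc : ℕ → ℝ),
      (∀ᶠ k in atTop, IsLUB {μ : ℝ | ¬ (∀ (R R' : ℕ) (A : QCDLatticeObservable 2 R)
          (B : QCDLatticeObservable 2 R'), ∃ (C δ : ℝ) (S₀ : ℕ), 0 < δ ∧ ∀ S : ℕ, S₀ ≤ S → ∀ n : ℕ, n ≤ S →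
            ‖qcdLatticeConnectedCorr (reg.β k) (2 * S + 1) (fun _ : Fin 2 => μ) A B n‖ ≤
              C * Real.exp (-(δ * n)))} (mc k)) ∧
      Tendsto (fun k => (reg.mcrit k - mc k) * reg.Zm k / reg.a k) atTop (nhds 0) ∧
      reg.HasMassScaling ∧ (reg.scheme 0 0 0).HasAsymptoticScaling ∧
      (∀ᶠ k in atTop, (-1 : ℝ) < reg.mcrit k) ∧
      ∀ η : ℝ, 0 < η →
        (∀ᶠ k in atTop, ∀ t : ℝ, 0 ≤ t → ∃ δ : ℝ, 0 < δ ∧ ∀ (R R' : ℕ) (A : QCDLatticeObservable 2 R)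
            (B : QCDLatticeObservable 2 R'), ∃ (C : ℝ) (S₀ : ℕ), ∀ S : ℕ, S₀ ≤ S → ∀ n : ℕ, n ≤ S →
              ‖qcdLatticeConnectedCorr (reg.β k) (2 * S + 1)
                  (fun f => (reg.scheme (fun _ : Fin 2 => η) 0 0).mq f k + t) A B n‖ ≤
                C * Real.exp (-(δ * n))) ∧
        ∃ Δ : ℝ, 0 < Δ ∧ (reg.scheme (fun _ : Fin 2 => η) 0 0).HasLatticeMassGap Δ

/-- **Statement of stub S2 — chiral softness of the pinned two-flavour corner — THE GOLDSTONE INPUT** (∀-form).  Every two-flavour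
regularisation pinned at the intrinsic corner (corner, pin, `HasMassScaling`, asymptotic scaling, `m_crit > −1`
eventually) is chiral at zero: for every `ε > 0` some positive tuple has no uniform lattice gap `ε` (the gap closes as
`m → 0⁺`: Goldstone law if chiral symmetry breaks, anomaly matching otherwise; true in both Sharpe–Singleton
scenarios).  Literally the `N_f = 2` instance `EulerDescent.ChiralCornerSoftness 2 (Or.inl rfl)` of item
stmt-QuantumFields-16902 (refuter-checked 2026-08-16), stated inline. [folklore] -/
-- @[stub "birth"] (tag LIVE in the registrar seat's registered work copy `bc/ChirallyAnchoredQCDTwo_birth.lean`, on which `ledger skeleton check` ran; commented here: crux workfiles may not carry gate-reserved attributes)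
def ChiralCornerSoftnessTwo : Prop :=
  ∀ (reg : QCDRegularisation 2) (mc : ℕ → ℝ),
      (∀ᶠ k in atTop, IsLUB {μ : ℝ | ¬ (∀ (R R' : ℕ) (A : QCDLatticeObservable 2 R)
          (B : QCDLatticeObservable 2 R'), ∃ (C δ : ℝ) (S₀ : ℕ), 0 < δ ∧ ∀ S : ℕ, S₀ ≤ S → ∀ n : ℕ, n ≤ S →
            ‖qcdLatticeConnectedCorr (reg.β k) (2 * S + 1) (fun _ : Fin 2 => μ) A B n‖ ≤
              C * Real.exp (-(δ * n)))} (mc k)) →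
      Tendsto (fun k => (reg.mcrit k - mc k) * reg.Zm k / reg.a k) atTop (nhds 0) →
      reg.HasMassScaling → (reg.scheme 0 0 0).HasAsymptoticScaling →
      (∀ᶠ k in atTop, (-1 : ℝ) < reg.mcrit k) →
      reg.IsChiralAtZero

/-- **Statement of stub S3 — degenerate-base order transfer — THE ROUTE'S LEVER, weakest needed form** (∀-form).  On a two-flavour
regularisation pinned at the intrinsic corner: if the degenerate doublet `(η, η)`, `η > 0`, carries the ray
certificate and the uniform lattice rate `Δ > 0`, then EVERY tuple `m` with `η ≤ m_f` carries the same rate `Δ`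
("heavier quarks never refine the lattice", transported up from the positive-weight diagonal to the signed-weight
split tuples).  The `N_f = 2`, degenerate-base, pinned special case of the rank-2 crux `LatticeGapMonotone` (see the
`example` after §1). [folklore] -/
-- @[stub "birth"] (tag LIVE in the registrar seat's registered work copy `bc/ChirallyAnchoredQCDTwo_birth.lean`, on which `ledger skeleton check` ran; commented here: crux workfiles may not carry gate-reserved attributes)
def DoubletOrderTransfer : Prop :=
  ∀ (reg : QCDRegularisation 2) (mc : ℕ → ℝ),
      (∀ᶠ k in atTop, IsLUB {μ : ℝ | ¬ (∀ (R R' : ℕ) (A : QCDLatticeObservable 2 R)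
          (B : QCDLatticeObservable 2 R'), ∃ (C δ : ℝ) (S₀ : ℕ), 0 < δ ∧ ∀ S : ℕ, S₀ ≤ S → ∀ n : ℕ, n ≤ S →
            ‖qcdLatticeConnectedCorr (reg.β k) (2 * S + 1) (fun _ : Fin 2 => μ) A B n‖ ≤
              C * Real.exp (-(δ * n)))} (mc k)) →
      Tendsto (fun k => (reg.mcrit k - mc k) * reg.Zm k / reg.a k) atTop (nhds 0) →
      reg.HasMassScaling → (reg.scheme 0 0 0).HasAsymptoticScaling →
      (∀ᶠ k in atTop, (-1 : ℝ) < reg.mcrit k) →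
      ∀ (η : ℝ) (m : Fin 2 → ℝ) (Δ : ℝ), (∀ f, η ≤ m f) → 0 < η → 0 < Δ →
        (∀ᶠ k in atTop, ∀ t : ℝ, 0 ≤ t → ∃ δ : ℝ, 0 < δ ∧ ∀ (R R' : ℕ) (A : QCDLatticeObservable 2 R)
            (B : QCDLatticeObservable 2 R'), ∃ (C : ℝ) (S₀ : ℕ), ∀ S : ℕ, S₀ ≤ S → ∀ n : ℕ, n ≤ S →
              ‖qcdLatticeConnectedCorr (reg.β k) (2 * S + 1)
                  (fun f => (reg.scheme (fun _ : Fin 2 => η) 0 0).mq f k + t) A B n‖ ≤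
                C * Real.exp (-(δ * n))) →
        (reg.scheme (fun _ : Fin 2 => η) 0 0).HasLatticeMassGap Δ →
        (reg.scheme m 0 0).HasLatticeMassGap Δ

/-- **Statement of stub S4 — the continuum body of a pinned two-flavour regularisation — THE CONTINUUM HALF for the SAME `reg`**
(∀-form).  On a two-flavour regularisation pinned at the intrinsic corner with a uniform lattice gap at EVERY positive
tuple: for every positive tuple `m` there are species renormalisations `z, shift` and OS data `T` with
`IsQCDAlong (reg.scheme m z shift) T` (full-sequence convergence, asymptotic scaling, physical branch), non-trivial and
non-Gaussian glue, every flavour-changing pseudoscalar non-trivial (dynamical quarks — honest because the pin ties the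
renormalised masses to light Wilson quarks), and a continuum gap `T.HasMassGap Δ`, `Δ > 0`.  The route header's
`ContinuumBodyOfPinned₂`; same-`reg` shape as `EulerDescent.RetypedContinuumComplement` with the pin in place of the
heavy body (E0′ tightness and mass-equicontinuity from the gap, E1 rotation restoration, spectral transfer of the
lattice gap; open). [folklore] -/
-- @[stub "birth"] (tag LIVE in the registrar seat's registered work copy `bc/ChirallyAnchoredQCDTwo_birth.lean`, on which `ledger skeleton check` ran; commented here: crux workfiles may not carry gate-reserved attributes)
def ContinuumBodyOfPinnedTwo : Prop :=
  ∀ (reg : QCDRegularisation 2) (mc : ℕ → ℝ),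
      (∀ᶠ k in atTop, IsLUB {μ : ℝ | ¬ (∀ (R R' : ℕ) (A : QCDLatticeObservable 2 R)
          (B : QCDLatticeObservable 2 R'), ∃ (C δ : ℝ) (S₀ : ℕ), 0 < δ ∧ ∀ S : ℕ, S₀ ≤ S → ∀ n : ℕ, n ≤ S →
            ‖qcdLatticeConnectedCorr (reg.β k) (2 * S + 1) (fun _ : Fin 2 => μ) A B n‖ ≤
              C * Real.exp (-(δ * n)))} (mc k)) →
      Tendsto (fun k => (reg.mcrit k - mc k) * reg.Zm k / reg.a k) atTop (nhds 0) →
      reg.HasMassScaling → (reg.scheme 0 0 0).HasAsymptoticScaling →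
      (∀ᶠ k in atTop, (-1 : ℝ) < reg.mcrit k) →
      (∀ m : Fin 2 → ℝ, (∀ f, 0 < m f) → ∃ Δ : ℝ, 0 < Δ ∧ (reg.scheme m 0 0).HasLatticeMassGap Δ) →
      ∀ m : Fin 2 → ℝ, (∀ f, 0 < m f) →
        ∃ (z shift : QCDField 2 → ℕ → ℝ) (T : OSData (QCDField 2) 4),
          IsQCDAlong (reg.scheme m z shift) T ∧ T.IsNontrivial QCDField.glue ∧ T.IsNonGaussian QCDField.glue ∧
            (∀ f g : Fin 2, f ≠ g → T.IsNontrivial (QCDField.pseudoRe f g)) ∧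
              ∃ Δ : ℝ, 0 < Δ ∧ T.HasMassGap Δ

/-! ## §2 The registered stubs (the ONLY `sorry`s of this file) -/

/-- **(S1)** the pinned degenerate-doublet anchors exist (`PinnedDoubletAnchors`; size XL / open — light two-flavour
Wilson lattice QCD gapped uniformly along an asymptotically free sequence, in the positive-weight regime). -/
theorem stub_pinnedDoubletAnchors : PinnedDoubletAnchors := by
  sorry

/-- **(S2)** chiral softness of every corner-pinned two-flavour regularisation (`ChiralCornerSoftnessTwo`; open —
Goldstone / anomaly matching; `= EulerDescent.ChiralCornerSoftness 2 (Or.inl rfl)`, item stmt-QuantumFields-16902). -/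
theorem stub_chiralCornerSoftnessTwo : ChiralCornerSoftnessTwo := by
  sorry

/-- **(S3)** degenerate-base order transfer on corner-pinned two-flavour regularisations (`DoubletOrderTransfer`;
size XL — the `N_f = 2` special case of the rank-2 crux `LatticeGapMonotone`, see `doubletOrderTransfer_of_latticeGapMonotone`). -/
theorem stub_doubletOrderTransfer : DoubletOrderTransfer := by
  sorry

/-- **(S4)** the continuum body of every corner-pinned, everywhere-gapped two-flavour regularisation
(`ContinuumBodyOfPinnedTwo`; size XL / open — E0′ tightness, E1 restoration, non-triviality, spectral transfer). -/
theorem stub_continuumBodyOfPinnedTwo : ContinuumBodyOfPinnedTwo := by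
  sorry

/-! ## §3 Sorry-free glue -/

/-- Stub 3 IS the `N_f = 2`, degenerate-base special case of the route's rank-2 crux `LatticeGapMonotone`
(kernel-checked; the pinned package and the positivity side conditions are simply not needed by the general crux):
closing `LatticeGapMonotone` (item stmt-QuantumFields-8905) closes stub 3. [folklore] -/
theorem doubletOrderTransfer_of_latticeGapMonotone : LatticeGapMonotone → DoubletOrderTransfer :=
  fun hMono reg _ _ _ _ _ _ η m Δ hle _ _ hcert hgap => hMono 2 reg (fun _ => η) m Δ hle hcert hgap

/-- **The anchor below a positive doublet of masses**: the degenerate doublet at the smaller mass. [folklore] -/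
theorem exists_degenerate_anchor (m : Fin 2 → ℝ) (hm : ∀ f, 0 < m f) :
    ∃ η : ℝ, 0 < η ∧ ∀ f, η ≤ m f := by
  refine ⟨min (m 0) (m 1), lt_min (hm 0) (hm 1), fun f => ?_⟩
  fin_cases f
  · exact min_le_left _ _
  · exact min_le_right _ _

/-! ## §4 Composition (kernel-checked): the crux BY NAME from the four stub statements -/

/-- **THE CRUX FROM THE FOUR STUBS** — concludes `Summit.QuantumFields.QCD.Theses.QuarkMassMonotone.ChirallyAnchoredQCDTwo`
BY NAME from the four named stub statements, with a real proof.  Take the corner-pinned regularisation of S1.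
`HasMassScaling` is part of the pinned package; `IsChiralAtZero` is S2 applied to the package.  For a positive tuple
`m` the anchor is the degenerate doublet `(η, η)` at `η = min (m 0) (m 1)` (`0 < η ≤ m_f`): S1 gives its ray
certificate and a uniform lattice rate `Δ(η) > 0` — clause (c) verbatim — and S3 transports that rate to `m`, so EVERY
positive tuple is lattice-gapped; S4 applied to the package and to these gaps is clause (d).  All four stubs are
load-bearing. -/
theorem ChirallyAnchoredQCDTwo_of :
    PinnedDoubletAnchors → ChiralCornerSoftnessTwo → DoubletOrderTransfer → ContinuumBodyOfPinnedTwo →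
      ChirallyAnchoredQCDTwo := by
  intro hanchors hsoft htrans hbody
  obtain ⟨reg, mc, hcorner, hpin, hms, haf, hbr, hanch⟩ := hanchors
  -- every positive tuple is lattice-gapped: anchor at the degenerate doublet below it, then order transfer (S3)
  have hgapAll : ∀ m : Fin 2 → ℝ, (∀ f, 0 < m f) →
      ∃ Δ : ℝ, 0 < Δ ∧ (reg.scheme m 0 0).HasLatticeMassGap Δ := by
    intro m hm
    obtain ⟨η, hη, hle⟩ := exists_degenerate_anchor m hm
    obtain ⟨hcert, Δ, hΔ, hgap⟩ := hanch η hη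
    exact ⟨Δ, hΔ, htrans reg mc hcorner hpin hms haf hbr η m Δ hle hη hΔ hcert hgap⟩
  refine ⟨reg, hms, hsoft reg mc hcorner hpin hms haf hbr, ?_, hbody reg mc hcorner hpin hms haf hbr hgapAll⟩
  -- clause (c): co-initial certified gapped anchors, verbatim from S1 at the degenerate doublet below `m`
  intro m hm
  obtain ⟨η, hη, hle⟩ := exists_degenerate_anchor m hm
  obtain ⟨hcert, Δ, hΔ, hgap⟩ := hanch η hη
  exact ⟨fun _ => η, fun f => ⟨hη, hle f⟩, hcert, Δ, hΔ, hgap⟩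

/-- The crux along this skeleton, from the registered stubs (sorries only inside `stub_*`). -/
theorem chirallyAnchoredQCDTwo_of_stubs : ChirallyAnchoredQCDTwo :=
  ChirallyAnchoredQCDTwo_of stub_pinnedDoubletAnchors stub_chiralCornerSoftnessTwo stub_doubletOrderTransfer
    stub_continuumBodyOfPinnedTwo

/-- The same composition with every stub statement UNFOLDED to its raw signature (the form the BC3 probes were run
on: each raw signature `→ ChirallyAnchoredQCDTwo` and `→ QCD` fails by `exact? | simpa | aesop`). -/
example :
    (∃ (reg : QCDRegularisation 2) (mc : ℕ → ℝ),
      (∀ᶠ k in atTop, IsLUB {μ : ℝ | ¬ (∀ (R R' : ℕ) (A : QCDLatticeObservable 2 R)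
          (B : QCDLatticeObservable 2 R'), ∃ (C δ : ℝ) (S₀ : ℕ), 0 < δ ∧ ∀ S : ℕ, S₀ ≤ S → ∀ n : ℕ, n ≤ S →
            ‖qcdLatticeConnectedCorr (reg.β k) (2 * S + 1) (fun _ : Fin 2 => μ) A B n‖ ≤
              C * Real.exp (-(δ * n)))} (mc k)) ∧
      Tendsto (fun k => (reg.mcrit k - mc k) * reg.Zm k / reg.a k) atTop (nhds 0) ∧
      reg.HasMassScaling ∧ (reg.scheme 0 0 0).HasAsymptoticScaling ∧
      (∀ᶠ k in atTop, (-1 : ℝ) < reg.mcrit k) ∧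
      ∀ η : ℝ, 0 < η →
        (∀ᶠ k in atTop, ∀ t : ℝ, 0 ≤ t → ∃ δ : ℝ, 0 < δ ∧ ∀ (R R' : ℕ) (A : QCDLatticeObservable 2 R)
            (B : QCDLatticeObservable 2 R'), ∃ (C : ℝ) (S₀ : ℕ), ∀ S : ℕ, S₀ ≤ S → ∀ n : ℕ, n ≤ S →
              ‖qcdLatticeConnectedCorr (reg.β k) (2 * S + 1)
                  (fun f => (reg.scheme (fun _ : Fin 2 => η) 0 0).mq f k + t) A B n‖ ≤
                C * Real.exp (-(δ * n))) ∧
        ∃ Δ : ℝ, 0 < Δ ∧ (reg.scheme (fun _ : Fin 2 => η) 0 0).HasLatticeMassGap Δ) →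
    (∀ (reg : QCDRegularisation 2) (mc : ℕ → ℝ),
      (∀ᶠ k in atTop, IsLUB {μ : ℝ | ¬ (∀ (R R' : ℕ) (A : QCDLatticeObservable 2 R)
          (B : QCDLatticeObservable 2 R'), ∃ (C δ : ℝ) (S₀ : ℕ), 0 < δ ∧ ∀ S : ℕ, S₀ ≤ S → ∀ n : ℕ, n ≤ S →
            ‖qcdLatticeConnectedCorr (reg.β k) (2 * S + 1) (fun _ : Fin 2 => μ) A B n‖ ≤
              C * Real.exp (-(δ * n)))} (mc k)) →
      Tendsto (fun k => (reg.mcrit k - mc k) * reg.Zm k / reg.a k) atTop (nhds 0) →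
      reg.HasMassScaling → (reg.scheme 0 0 0).HasAsymptoticScaling →
      (∀ᶠ k in atTop, (-1 : ℝ) < reg.mcrit k) →
      reg.IsChiralAtZero) →
    (∀ (reg : QCDRegularisation 2) (mc : ℕ → ℝ),
      (∀ᶠ k in atTop, IsLUB {μ : ℝ | ¬ (∀ (R R' : ℕ) (A : QCDLatticeObservable 2 R)
          (B : QCDLatticeObservable 2 R'), ∃ (C δ : ℝ) (S₀ : ℕ), 0 < δ ∧ ∀ S : ℕ, S₀ ≤ S → ∀ n : ℕ, n ≤ S →
            ‖qcdLatticeConnectedCorr (reg.β k) (2 * S + 1) (fun _ : Fin 2 => μ) A B n‖ ≤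
              C * Real.exp (-(δ * n)))} (mc k)) →
      Tendsto (fun k => (reg.mcrit k - mc k) * reg.Zm k / reg.a k) atTop (nhds 0) →
      reg.HasMassScaling → (reg.scheme 0 0 0).HasAsymptoticScaling →
      (∀ᶠ k in atTop, (-1 : ℝ) < reg.mcrit k) →
      ∀ (η : ℝ) (m : Fin 2 → ℝ) (Δ : ℝ), (∀ f, η ≤ m f) → 0 < η → 0 < Δ →
        (∀ᶠ k in atTop, ∀ t : ℝ, 0 ≤ t → ∃ δ : ℝ, 0 < δ ∧ ∀ (R R' : ℕ) (A : QCDLatticeObservable 2 R)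
            (B : QCDLatticeObservable 2 R'), ∃ (C : ℝ) (S₀ : ℕ), ∀ S : ℕ, S₀ ≤ S → ∀ n : ℕ, n ≤ S →
              ‖qcdLatticeConnectedCorr (reg.β k) (2 * S + 1)
                  (fun f => (reg.scheme (fun _ : Fin 2 => η) 0 0).mq f k + t) A B n‖ ≤
                C * Real.exp (-(δ * n))) →
        (reg.scheme (fun _ : Fin 2 => η) 0 0).HasLatticeMassGap Δ →
        (reg.scheme m 0 0).HasLatticeMassGap Δ) →
    (∀ (reg : QCDRegularisation 2) (mc : ℕ → ℝ),
      (∀ᶠ k in atTop, IsLUB {μ : ℝ | ¬ (∀ (R R' : ℕ) (A : QCDLatticeObservable 2 R)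
          (B : QCDLatticeObservable 2 R'), ∃ (C δ : ℝ) (S₀ : ℕ), 0 < δ ∧ ∀ S : ℕ, S₀ ≤ S → ∀ n : ℕ, n ≤ S →
            ‖qcdLatticeConnectedCorr (reg.β k) (2 * S + 1) (fun _ : Fin 2 => μ) A B n‖ ≤
              C * Real.exp (-(δ * n)))} (mc k)) →
      Tendsto (fun k => (reg.mcrit k - mc k) * reg.Zm k / reg.a k) atTop (nhds 0) →
      reg.HasMassScaling → (reg.scheme 0 0 0).HasAsymptoticScaling →
      (∀ᶠ k in atTop, (-1 : ℝ) < reg.mcrit k) →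
      (∀ m : Fin 2 → ℝ, (∀ f, 0 < m f) → ∃ Δ : ℝ, 0 < Δ ∧ (reg.scheme m 0 0).HasLatticeMassGap Δ) →
      ∀ m : Fin 2 → ℝ, (∀ f, 0 < m f) →
        ∃ (z shift : QCDField 2 → ℕ → ℝ) (T : OSData (QCDField 2) 4),
          IsQCDAlong (reg.scheme m z shift) T ∧ T.IsNontrivial QCDField.glue ∧ T.IsNonGaussian QCDField.glue ∧
            (∀ f g : Fin 2, f ≠ g → T.IsNontrivial (QCDField.pseudoRe f g)) ∧
              ∃ Δ : ℝ, 0 < Δ ∧ T.HasMassGap Δ) →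
    ChirallyAnchoredQCDTwo :=
  ChirallyAnchoredQCDTwo_of

end Summit.QuantumFields.QCD.Cruxes.ChirallyAnchoredQCDTwo.Birth
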